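import Mathlib
import HarnessLib
import Literature.Computability.AlgebraicComplexity.AsymptoticSpectrum
import Literature.Computability.AlgebraicComplexity.BorderRankCW
import Literature.Computability.AlgebraicComplexity.TensorRestrictionRank
import Literature.Computability.AlgebraicComplexity.KroneckerRank
import Literature.Computability.AlgebraicComplexity.CoppersmithWinograd1990Proofs
import Literature.Computability.AlgebraicComplexity.LaserMethodRestriction
import Literature.Computability.AlgebraicComplexity.LaserMethodTypeCount
import Literature.Computability.AlgebraicComplexity.MaxEntropyGivenMarginals
import Summits.MatrixMultiplication.Statement
import Summits.MatrixMultiplication.MatrixMultiplication.Theses.OutsiderSandwich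
import Summits.MatrixMultiplication.MatrixMultiplication.Theorems.OutsiderSandwichHalfMMFinite

/-!
# OutsiderSandwichHalfMM, part 3/3 — the route's aside items BY NAME (route `OutsiderSandwich`, rev 3)

Last file of the landing chain `OutsiderSandwichHalfMMDiagonal` → `OutsiderSandwichHalfMMFinite` →
`OutsiderSandwichHalfMM` for `Summits/…/Theses/OutsiderSandwich.lean` (`route-MatrixMultiplication-OutsiderSandwich`,
rev 3; TOP crux `CwTwoMMPerfect` = item `stmt-MatrixMultiplication-27896`).  It PROVES BY NAME four aside items
of the route (section `Items`): `HalfMM` = `stmt-MatrixMultiplication-28619` (`halfMM_holds`), `CwTwoRateHalfMM` =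
`stmt-MatrixMultiplication-28620` (`cwTwoRateHalfMM_holds`, a BC5/T3 witness rung of the deciding crux),
`CwTwoMMPerfectOfSmallSlack` = `stmt-MatrixMultiplication-28621` (`cwTwoMMPerfectOfSmallSlack_holds`) and
`MMInCwTwoPowTwoTwo` = `stmt-MatrixMultiplication-28736` (`mmInCwTwoPowTwoTwo_holds`, the finite instance
`I(2,2)`).  Sorry-free, NO hypothesis; land (after parts 1 and 2) verbatim with

  `ledger propose --kind proof --target Summits/MatrixMultiplication/MatrixMultiplication/Theorems/OutsiderSandwichHalfMM.lean
     --file OutsiderSandwichHalfMM.lean --workitem stmt-MatrixMultiplication-28620`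

(the other three items close by type match; the file also `--supports stmt-MatrixMultiplication-27896`), then
`harness/cli/tribunal check route-MatrixMultiplication-OutsiderSandwich --witness
Summit.MatrixMultiplication.MatrixMultiplication.Theorems.OutsiderSandwichHalfMM.cwTwoRateHalfMM_holds --full`
(clears the route's `t3:absent`).

CONTENT.  HYPOTHESIS-FREE: `CwTwoRate c` for every `0 ≤ c < 4^{log₆ 3} = 2.3397` (`cwTwoRate_halfMM`, from
parts 1–2), the TOP crux above slack `log₆(3/2)` (`cwTwoMMPerfect_above_slack`) and BY NAME for the route decl:
`Theses.OutsiderSandwich.CwTwoMMPerfect ↔ (its instances with 0 < ε ≤ log₆(3/2) = 0.2263)`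
(`cwTwoMMPerfect_iff_small_slack`).  In the route's currency: `q* ≥ 2 log₆ 3 = 1.2263` bits of matrix
multiplication per copy of `cw₂` (TOP = `log₂ 3 = 1.585`; the companion chain `OutsiderSandwichLaserMerge`
lifts the kernel rung further to `2^{ℓ(2.37295)} = 2.714`, i.e. `1.4406` bits).

Sources: CoppersmithWinograd1990 (§11), Blaser2013 (§5.2), ConnerGesmundoLandsbergVentura2022, Strassen1991 /
BurgisserClausenShokrollahi1997 Thm. 15.39–15.41, LeGall2014 (App. A.3).
-/

set_option linter.dupNamespace false -- `MatrixMultiplication.MatrixMultiplication` (summit = problem, D-0017)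

namespace Summit.MatrixMultiplication.MatrixMultiplication.Theorems.OutsiderSandwichHalfMM

open scoped BigOperators
open Literature.Computability.AlgebraicComplexity


/-! ## (g5) The TOP crux above slack `log₆(3/2)`

`CwTwoMMPerfect` is `∀ ε > 0, P ε` with `P ε := ∀ N₀, ∃ N ≥ N₀, ∃ m, ⟨m,m,m⟩ ≤ cw₂^{⊠N} ∧ 3^{(1-ε)N} ≤ m²`.
Since `3^{1-ε} < 4^{log₆3} ⟺ ε > 1 - log₆ 4 = log₆(3/2)`, the diagonal + half-MM give `P ε` for every
`ε > log₆(3/2) = 0.2263` (kernel before g5: `ε > 1 - (log₃4)/3 = 0.5794` from `I(3,2)`; `I(2,2)` alone: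
`ε ≥ 1 - log₃ 2 = 0.3691`); what remains of TOP is exactly the range `0 < ε ≤ log₆(3/2)`. -/

section Slack

/-- `3^{1-ε} < 4^{log₆ 3}` as soon as `ε > log₆(3/2)` (note `4^{log₆3} = 3^{log₆4}`). [folklore] -/
theorem three_rpow_lt_of_slack {ε : ℝ} (hε : Real.logb 6 (3 / 2) < ε) :
    (3 : ℝ) ^ (1 - ε) < (4 : ℝ) ^ Real.logb 6 3 := by
  have hL2 : 0 < Real.log 2 := Real.log_pos one_lt_two
  have hL3 : 0 < Real.log 3 := Real.log_pos (by norm_num)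
  have hL6 : Real.log 6 = Real.log 2 + Real.log 3 := by
    rw [show (6 : ℝ) = 2 * 3 by norm_num, Real.log_mul (by norm_num) (by norm_num)]
  have hL4 : Real.log 4 = 2 * Real.log 2 := by
    rw [show (4 : ℝ) = 2 ^ 2 by norm_num, Real.log_pow]; push_cast; ring
  have hL32 : Real.log (3 / 2) = Real.log 3 - Real.log 2 := Real.log_div (by norm_num) (by norm_num)
  rw [Real.logb, hL32, hL6, div_lt_iff₀ (add_pos hL2 hL3)] at hε
  rw [← Real.log_lt_log_iff (Real.rpow_pos_of_pos (by norm_num) _) (Real.rpow_pos_of_pos (by norm_num) _),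
    Real.log_rpow (by norm_num), Real.log_rpow (by norm_num), Real.logb, hL6, hL4, div_mul_eq_mul_div,
    lt_div_iff₀ (add_pos hL2 hL3)]
  nlinarith [mul_lt_mul_of_pos_right hε hL3, mul_pos hL2 hL3]

/-- **`P ε` for every `ε > log₆(3/2)`** (given the diagonal; see the section docstring). [new] -/
theorem cwTwoMMPerfect_above_slack
    (hD : ∀ ε : ℝ, 0 < ε → ∀ N₀ : ℕ, ∃ N : ℕ, N₀ ≤ N ∧ ∃ r : ℕ,
      TensorRestrictsTo (kroneckerPow (cwTensor ℂ 2) N) (unitTensor ℂ r) ∧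
        (3 : ℝ) ^ ((1 - ε) * N) ≤ (r : ℝ))
    {ε : ℝ} (hε : Real.logb 6 (3 / 2) < ε) (N₀ : ℕ) :
    ∃ N : ℕ, N₀ ≤ N ∧ ∃ m : ℕ,
      TensorRestrictsTo (kroneckerPow (cwTensor ℂ 2) N) (matMulTensor ℂ m m m) ∧
        (3 : ℝ) ^ ((1 - ε) * N) ≤ (m : ℝ) ^ 2 := by
  rcases lt_or_ge ε 1 with h1 | h1
  · have hc1 : (1 : ℝ) < (3 : ℝ) ^ (1 - ε) := Real.one_lt_rpow (by norm_num) (by linarith)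
    obtain ⟨N, hN, m, hres, hc⟩ :=
      rate_of_halfMM_of_diagonal hD hc1 (three_rpow_lt_of_slack hε) N₀
    refine ⟨N, hN, m, hres, ?_⟩
    rwa [← Real.rpow_natCast ((3 : ℝ) ^ (1 - ε)) N, ← Real.rpow_mul (by norm_num : (0 : ℝ) ≤ 3)] at hc
  · obtain ⟨N, hN, m, hres, hc⟩ := rate_of_halfMM_of_diagonal hD one_lt_two
      (lt_trans (by norm_num : (2 : ℝ) < 9 / 4) nine_fourths_lt_four_rpow_logb_six_three) N₀
    refine ⟨N, hN, m, hres, ?_⟩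
    have h1m : (1 : ℝ) ≤ (m : ℝ) ^ 2 := (one_le_pow₀ (by norm_num : (1 : ℝ) ≤ 2)).trans hc
    have h31 : (3 : ℝ) ^ ((1 - ε) * N) ≤ 1 :=
      Real.rpow_le_one_of_one_le_of_nonpos (by norm_num)
        (mul_nonpos_of_nonpos_of_nonneg (by linarith) (Nat.cast_nonneg _))
    linarith

end Slack


/-! ## Hypothesis-free forms and the link to the route's TOP crux `Theses.OutsiderSandwich.CwTwoMMPerfect` -/

section RungsG5

/-- **KERNEL RUNG (g5): rate `c` for every `0 ≤ c < 4^{log₆ 3} = 2.3397`** — ω-free, NO hypothesis: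
cofinally in `N` some `⟨m,m,m⟩ ≤ cw₂^{⊠N}` has `c^N ≤ m²`. [new] -/
theorem cwTwoRate_halfMM {c : ℝ} (hc0 : 0 ≤ c) (hc : c < (4 : ℝ) ^ Real.logb 6 3) (N₀ : ℕ) :
    ∃ N : ℕ, N₀ ≤ N ∧ ∃ m : ℕ,
      TensorRestrictsTo (kroneckerPow (cwTensor ℂ 2) N) (matMulTensor ℂ m m m) ∧ c ^ N ≤ (m : ℝ) ^ 2 := by
  rcases lt_or_ge 1 c with h1 | h1
  · exact rate_of_halfMM_of_diagonal diagonalAchieved h1 hc N₀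
  · obtain ⟨N, hN, m, hres, h2⟩ := rate_of_halfMM_of_diagonal diagonalAchieved one_lt_two
      (lt_trans (by norm_num : (2 : ℝ) < 9 / 4) nine_fourths_lt_four_rpow_logb_six_three) N₀
    exact ⟨N, hN, m, hres, (pow_le_pow_left₀ hc0 (h1.trans one_le_two) N).trans h2⟩

/-- **What remains of the TOP crux (kernel, exact, by name)**:
`Theses.OutsiderSandwich.CwTwoMMPerfect ↔` its instances with `0 < ε ≤ log₆(3/2) = 0.2263…`. [new] -/
theorem cwTwoMMPerfect_iff_small_slack :
    Summit.MatrixMultiplication.MatrixMultiplication.Theses.OutsiderSandwich.CwTwoMMPerfect ↔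
      ∀ ε : ℝ, 0 < ε → ε ≤ Real.logb 6 (3 / 2) → ∀ N₀ : ℕ, ∃ N : ℕ, N₀ ≤ N ∧ ∃ m : ℕ,
        TensorRestrictsTo (kroneckerPow (cwTensor ℂ 2) N) (matMulTensor ℂ m m m) ∧
          (3 : ℝ) ^ ((1 - ε) * N) ≤ (m : ℝ) ^ 2 :=
  ⟨fun h ε hε _ => h ε hε, fun h ε hε N₀ =>
    (le_or_gt ε (Real.logb 6 (3 / 2))).elim (fun hle => h ε hε hle N₀)
      fun hlt => cwTwoMMPerfect_above_slack diagonalAchieved hlt N₀⟩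

end RungsG5

/-! ## The route's aside items, by name (route file rev 3) -/

section Items

/-- **item `stmt-MatrixMultiplication-28619`** (`Theses.OutsiderSandwich.HalfMM`, aside):
`⟨2,2,2⟩ ≤ cw₂ ⊠ ⟨2⟩`. [new] -/
theorem halfMM_holds :
    Summit.MatrixMultiplication.MatrixMultiplication.Theses.OutsiderSandwich.HalfMM := halfMM

/-- **item `stmt-MatrixMultiplication-28620`** (`Theses.OutsiderSandwich.CwTwoRateHalfMM`, aside; the
route's BC5 / T3 witness rung of the deciding crux `CwTwoMMPerfect`): rate `c` on `cw₂`-powers for every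
`0 ≤ c < 4^{log₆3}`, ω-free, no hypothesis. [new] -/
theorem cwTwoRateHalfMM_holds :
    Summit.MatrixMultiplication.MatrixMultiplication.Theses.OutsiderSandwich.CwTwoRateHalfMM :=
  fun _c hc0 hc N₀ => cwTwoRate_halfMM hc0 hc N₀

/-- **item `stmt-MatrixMultiplication-28621`** (`Theses.OutsiderSandwich.CwTwoMMPerfectOfSmallSlack`,
aside): the TOP crux follows from its instances with slack `0 < ε ≤ log₆(3/2)`. [new] -/
theorem cwTwoMMPerfectOfSmallSlack_holds :
    Summit.MatrixMultiplication.MatrixMultiplication.Theses.OutsiderSandwich.CwTwoMMPerfectOfSmallSlack :=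
  fun h => cwTwoMMPerfect_iff_small_slack.mpr h

/-- **item `stmt-MatrixMultiplication-28736`** (`Theses.OutsiderSandwich.MMInCwTwoPowTwoTwo`, aside):
the finite instance `I(2,2)`, `⟨2,2,2⟩ ≤ cw₂^{⊠2}` — the route's named cheapest falsifier, decided TRUE. [new] -/
theorem mmInCwTwoPowTwoTwo_holds :
    Summit.MatrixMultiplication.MatrixMultiplication.Theses.OutsiderSandwich.MMInCwTwoPowTwoTwo :=
  mmInCwTwoPow_two_two

end Items

end Summit.MatrixMultiplication.MatrixMultiplication.Theorems.OutsiderSandwichHalfMM
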